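import Literature.NumberTheory.EllipticCurves.Greenberg1999.TwoTorsionOddIsogenyDualProofs
import Literature.NumberTheory.EllipticCurves.Greenberg1999.TwoTorsionRamifiedAtTwoValuationProofs
import HarnessLib

/-!
# Greenberg's "ramified at `2`" condition is DUAL under the `2`-isogeny `E → E/⟨P⟩`; his Prop. 5.13 /
# 5.14 configurations along the isogeny (proofs only; `2`-adic half and assembly)

Topic `NumberTheory/EllipticCurves/Greenberg1999`; theorem-only companion (no definition, no named
fact, no instance, no `sorry`) of `TwoTorsionMuInvariant` (R. Greenberg, LNM 1716 (1999), §5,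
Props. 5.13 / 5.14 at `p = 2`: `TwoTorsionRamifiedAtTwo x := v₂(x) < 0`, `TwoTorsionOdd`), of
`TwoTorsionRamifiedAtTwoValuationProofs` (`a₁` odd ⟹ a rational `2`-torsion abscissa has
`v₂(x) ∈ {-2} ∪ [0, ∞)`) and of the archimedean sibling `TwoTorsionOddIsogenyDualProofs` (setting
`C • W = V`, `C' • W' = V.twoIsogenyCodomain`, `P = (C.r, C.t) ↦ P' = (C'.r, C'.t)` = generator of the
kernel of the dual isogeny; "odd" is dual).

**Theorems.**
* §3 On a globally minimal equation with `a₁` odd (good ORDINARY or MULTIPLICATIVE at `2`):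
  `padicValRat_add_twelve_mul_eq_zero` / `…_eq_one` — `v₂(b₂ + 12x) = 0` if `v₂(x) ≥ 0`, `= 1` if
  `v₂(x) = -2` (`x = n/4m`, `n, m` odd, `8 ∣ n + b₂m` from the cubic); `padicValRat_a₂_smul_eq` —
  `v₂(a₂(C • W)) = v₂(b₂ + 12r) - 2 - 2v₂(u)`; hence the DICTIONARY
  **`twoTorsionRamifiedAtTwo_iff_odd_padicValRat_a₂`** — `⟨P⟩` is ramified at `2` iff `v₂(a₂)` of a
  (any) two-torsion normal form with `P` at `(0,0)` is ODD (the scale `u` shifts it by an even amount);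
  `padicValRat_twoIsogenyCodomain_a₂` — `a₂(V') = -2a₂(V)` raises `v₂` by `1`; hence
  **`twoTorsionRamifiedAtTwo_iff_not_of_twoIsogeny` : `⟨P⟩` is ramified at `2` ⟺ `⟨P'⟩` is NOT.**
  (Structure picture, not formalised: `C₂ = Ê[2^∞]` is the connected part; an isogeny with étale
  kernel is an isomorphism on formal groups, so `ker φ̂ = φ(E[2]) = φ(C₂[2])` is connected; and
  conversely.)
* §4 **Greenberg's configurations along the isogeny** (`ramified_odd_dual_of_twoIsogeny`): Prop. 5.14's
  hypothesis «ramified at `2` but not odd, or odd but not ramified» holds at `(E, P)` iff at `(E', P')`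
  (`prop514Hypothesis_iff_of_twoIsogeny`) — the printed `μ = 0` criterion at `2` is a property of the
  `ℤ/2`-linked PAIR; Prop. 5.13's hypothesis «ramified AND odd» (`μ ≥ 1`) holds at `(E, P)` iff `⟨P'⟩`
  is «NEITHER» (`ramified_and_odd_iff_neither_of_twoIsogeny`) — the configuration on which §5 is
  silent; so exactly one of «5.14 at both ends» / «5.13 at one end, neither at the other» occurs
  (`prop514_both_or_prop513_neither_of_twoIsogeny`).  Greenberg's conductor-15 table (p. 123: on 15a3
  `(3/4, -7/8)` generates `C₂[2]`, `(-3, 1)` generates `C_∞[2]`) and the cell's census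
  `O1D-GREENBERG-L1.tsv` (every 2-member class shows complementary flags; 169 good-ordinary classes
  with rational `2`-torsion = 83 with a 5.14 point ⊔ 86 without) are instances.

Written for the BSD cell `bsd-2adic` (stratum (β) of the off-habitat complement of the rank-0
`2`-converse at a good ordinary `2`).  Nothing about BSD, `μ`, `λ` or Selmer groups is PROVED here (the
`μ`-statements stay Greenberg's named facts `prop514_isTorsion_mu_eq_zero_two` /
`prop513_one_le_mu_two_of_ramified_odd`); these are statements about rational numbers.

## References
* [GreenbergLNM1716] R. Greenberg, *Iwasawa theory for elliptic curves*, LNM 1716 (1999), §5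
  pp. 120–124 (Props. 5.13, 5.14, Remark, conductor-15 example; chunks p0168–p0176), §2 (`C_v`).
* [SilvermanAEC2009] J. H. Silverman, *The Arithmetic of Elliptic Curves*, 2nd ed., GTM 106 (2009),
  III.1, III.4 Example 4.5, III.6.1, VII.2–VII.3 (`E₁(ℚ₂)`), Exercise 8.15(a).
-/

set_option autoImplicit false

open WeierstrassCurve

namespace Literature.NumberTheory.EllipticCurves.Greenberg1999

/-! ### §3. The `2`-adic condition "ramified at `2`" along the isogeny -/

section Ramified

/-- `v₂(B₂ + 12x) = 0` for `B₂` odd and `v₂(x) ≥ 0` (then `x` has odd denominator and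
`B₂·den + 12·num` is odd); in particular `B₂ + 12x ≠ 0`. [folklore] -/
private theorem padicValRat_add_twelve_mul_eq_zero {x : ℚ} {B₂ : ℤ} (hB₂ : Odd B₂)
    (hx : 0 ≤ padicValRat 2 x) : (B₂ : ℚ) + 12 * x ≠ 0 ∧ padicValRat 2 ((B₂ : ℚ) + 12 * x) = 0 := by
  haveI : Fact (Nat.Prime 2) := ⟨Nat.prime_two⟩
  -- the denominator of `x` is odd
  have hden : ¬ 2 ∣ x.den := by
    intro h2
    by_cases hx0 : x = 0
    · simp [hx0] at h2
    · have hcop : Nat.Coprime x.num.natAbs x.den := x.reduced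
      have hnum : ¬ (2 : ℤ) ∣ x.num := by
        intro hn
        have h2n : 2 ∣ x.num.natAbs := Int.natAbs_dvd_natAbs.mpr hn
        have h22 : Nat.Coprime 2 2 := Nat.Coprime.coprime_dvd_left h2n (hcop.coprime_dvd_right h2)
        exact absurd ((Nat.coprime_self 2).mp h22) (by norm_num)
      rw [padicValRat_def, padicValInt.eq_zero_of_not_dvd hnum] at hx
      have : 1 ≤ padicValNat 2 x.den :=
        one_le_padicValNat_of_dvd (Rat.den_ne_zero x) h2
      omega
  set N : ℤ := B₂ * x.den + 12 * x.num with hN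
  have hNodd : Odd N := by
    have hd : Odd (x.den : ℤ) := by
      rcases Int.even_or_odd (x.den : ℤ) with he | ho
      · exact absurd (by exact_mod_cast even_iff_two_dvd.mp he) hden
      · exact ho
    exact (hB₂.mul hd).add_even ⟨6 * x.num, by ring⟩
  have hN0 : (N : ℚ) ≠ 0 := by exact_mod_cast fun h0 ↦ (Int.not_even_iff_odd.mpr hNodd) (by simp [h0])
  have hd0 : (x.den : ℚ) ≠ 0 := by exact_mod_cast x.den_ne_zero
  have hxm : x * (x.den : ℚ) = (x.num : ℚ) :=
    ((div_eq_iff hd0).mp (Rat.num_div_den x)).symm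
  have hsum : (B₂ : ℚ) + 12 * x = (N : ℚ) / (x.den : ℚ) := by
    rw [eq_div_iff hd0, hN]
    push_cast
    linear_combination 12 * hxm
  refine ⟨by rw [hsum]; exact div_ne_zero hN0 hd0, ?_⟩
  rw [hsum, padicValRat.div hN0 hd0, padicValRat.of_int,
    padicValInt.eq_zero_of_not_dvd (by simpa [even_iff_two_dvd] using Int.not_even_iff_odd.mpr hNodd),
    padicValRat.of_nat, padicValNat.eq_zero_of_not_dvd hden]
  simp

/-- `v₂(B₂ + 12x) = 1` for `B₂` odd and a root `x` of `4x³ + B₂x² + 2B₄x + B₆` (`Bᵢ ∈ ℤ`) with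
`v₂(x) < 0`: then `x = n/(4m)` with `n, m` odd and `n³ + B₂n²m + 8B₄nm² + 16B₆m³ = 0`, so
`8 ∣ n + B₂m` and `B₂m + 3n = 2·(n + 4k)` is twice an odd number. [cite: GreenbergLNM1716, §5 examples pp. 121–122 (the abscissa 3/4 of the generator of C₂[2] on 15a3)] -/
theorem padicValRat_add_twelve_mul_eq_one {x : ℚ} {B₂ B₄ B₆ : ℤ} (hB₂ : Odd B₂)
    (h : 4 * x ^ 3 + B₂ * x ^ 2 + 2 * B₄ * x + B₆ = 0) (hneg : padicValRat 2 x < 0) :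
    (B₂ : ℚ) + 12 * x ≠ 0 ∧ padicValRat 2 ((B₂ : ℚ) + 12 * x) = 1 := by
  haveI : Fact (Nat.Prime 2) := ⟨Nat.prime_two⟩
  have hm : 2 ∣ x.den := by
    by_contra hnd
    rw [padicValRat_def, padicValNat.eq_zero_of_not_dvd hnd] at hneg
    omega
  obtain ⟨m₂, hm₂odd, hden, hnodd⟩ := den_eq_four_mul_odd_of_twoDivision_root hB₂ h hm
  set n : ℤ := x.num with hn
  have hm₂0 : (m₂ : ℚ) ≠ 0 := by
    exact_mod_cast fun h0 ↦ (Int.not_even_iff_odd.mpr hm₂odd) (by simp [h0])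
  have hxm : x * (4 * (m₂ : ℚ)) = (n : ℚ) := by
    have h1 : (n : ℚ) / (x.den : ℚ) = x := Rat.num_div_den x
    have h2 : ((x.den : ℤ) : ℚ) = 4 * (m₂ : ℚ) := by exact_mod_cast hden
    have h3 : (x.den : ℚ) = 4 * (m₂ : ℚ) := by exact_mod_cast h2
    rw [← h1, h3, div_mul_cancel₀ _ (mul_ne_zero four_ne_zero hm₂0)]
  -- the integer equation `n³ + B₂n²m₂ + 8B₄nm₂² + 16B₆m₂³ = 0`
  have hZ : n ^ 3 + B₂ * n ^ 2 * m₂ + 8 * B₄ * n * m₂ ^ 2 + 16 * B₆ * m₂ ^ 3 = 0 := by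
    have hQ : ((n ^ 3 + B₂ * n ^ 2 * m₂ + 8 * B₄ * n * m₂ ^ 2 + 16 * B₆ * m₂ ^ 3 : ℤ) : ℚ) =
        16 * (m₂ : ℚ) ^ 3 * (4 * x ^ 3 + B₂ * x ^ 2 + 2 * B₄ * x + B₆) := by
      push_cast
      rw [← hxm]
      ring
    rw [h, mul_zero] at hQ
    exact_mod_cast hQ
  -- `n² = 8e + 1`
  obtain ⟨m, hm'⟩ := hnodd
  obtain ⟨e, he⟩ := (Int.even_mul_succ_self m).two_dvd
  have hsq : n ^ 2 = 8 * e + 1 := by rw [hm']; linear_combination 4 * he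
  -- `8 ∣ n + B₂ m₂`
  have h8 : ∃ k : ℤ, n + B₂ * m₂ = 8 * k := by
    refine ⟨-(e * (n + B₂ * m₂) + B₄ * n * m₂ ^ 2 + 2 * B₆ * m₂ ^ 3), ?_⟩
    have : n ^ 2 * (n + B₂ * m₂) = -(8 * B₄ * n * m₂ ^ 2 + 16 * B₆ * m₂ ^ 3) := by
      linear_combination hZ
    rw [hsq] at this
    linear_combination this
  obtain ⟨k, hk⟩ := h8
  -- `B₂ m₂ + 3n = 2 (n + 4k)` with `n + 4k` odd
  have hodd' : Odd (n + 4 * k) := ⟨m + 2 * k, by rw [hm']; ring⟩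
  have hN : B₂ * m₂ + 3 * n = 2 * (n + 4 * k) := by linear_combination hk
  have hN0 : ((B₂ * m₂ + 3 * n : ℤ) : ℚ) ≠ 0 := by
    rw [hN]
    exact_mod_cast mul_ne_zero two_ne_zero
      (fun h0 ↦ (Int.not_even_iff_odd.mpr hodd') (by simp [h0]))
  have hsum : (B₂ : ℚ) + 12 * x = ((B₂ * m₂ + 3 * n : ℤ) : ℚ) / (m₂ : ℚ) := by
    push_cast
    field_simp
    linear_combination 3 * hxm
  refine ⟨by rw [hsum]; exact div_ne_zero hN0 hm₂0, ?_⟩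
  have hvodd : padicValRat 2 ((n + 4 * k : ℤ) : ℚ) = 0 := by
    rw [padicValRat.of_int, padicValInt.eq_zero_of_not_dvd
      (by simpa [even_iff_two_dvd] using Int.not_even_iff_odd.mpr hodd')]
    simp
  have hvm₂ : padicValRat 2 (m₂ : ℚ) = 0 := by
    rw [padicValRat.of_int, padicValInt.eq_zero_of_not_dvd
      (by simpa [even_iff_two_dvd] using Int.not_even_iff_odd.mpr hm₂odd)]
    simp
  have hodd0 : ((n + 4 * k : ℤ) : ℚ) ≠ 0 := by
    exact_mod_cast fun h0 ↦ (Int.not_even_iff_odd.mpr hodd') (by simp [h0])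
  rw [hsum, padicValRat.div hN0 hm₂0, hN, Int.cast_mul, Int.cast_ofNat,
    padicValRat.mul two_ne_zero hodd0, hvodd, hvm₂,
    show (2 : ℚ) = ((2 : ℕ) : ℚ) by norm_num, padicValRat.self one_lt_two]
  simp

/-- **Parity of `v₂(a₂)` of a normal form is the parity of `v₂(b₂ + 12r)`**: `4·a₂(C • W) =
u⁻²(b₂ + 12r)`, so `v₂(a₂(C • W)) = v₂(b₂ + 12r) - 2 - 2v₂(u)` — the scale `u` only shifts by an
even amount. [cite: SilvermanAEC2009, III.1 Table 3.1] -/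
theorem padicValRat_a₂_smul_eq (W : WeierstrassCurve ℚ) (C : VariableChange ℚ) [(C • W).IsTwoTorsionNF]
    (h0 : W.b₂ + 12 * C.r ≠ 0) :
    padicValRat 2 (C • W).a₂ = padicValRat 2 (W.b₂ + 12 * C.r) - 2 - 2 * padicValRat 2 (C.u : ℚ) := by
  haveI : Fact (Nat.Prime 2) := ⟨Nat.prime_two⟩
  have h4 := four_mul_a₂_of_isTwoTorsionNF_smul W C
  have hU : ((C.u⁻¹ : ℚˣ) : ℚ) = (C.u : ℚ)⁻¹ := Units.val_inv_eq_inv_val C.u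
  rw [hU] at h4
  have hu0 : (C.u : ℚ) ≠ 0 := Units.ne_zero _
  have ha : (C • W).a₂ = (C.u : ℚ)⁻¹ ^ 2 * (W.b₂ + 12 * C.r) / 4 := by
    rw [← h4]; ring
  have hv4 : padicValRat 2 (4 : ℚ) = 2 := by
    rw [show (4 : ℚ) = ((2 : ℕ) : ℚ) ^ 2 by norm_num, padicValRat.pow, padicValRat.self one_lt_two]
    norm_num
  rw [ha, padicValRat.div (mul_ne_zero (pow_ne_zero _ (inv_ne_zero hu0)) h0) four_ne_zero,
    padicValRat.mul (pow_ne_zero _ (inv_ne_zero hu0)) h0, padicValRat.pow,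
    padicValRat.inv, hv4]
  ring

/-- `a₁` is odd on the minimal equation at a good ORDINARY or MULTIPLICATIVE `2`.
[cite: SilvermanAEC2009, Exercise 8.15(a) and VII.5.1] -/
theorem odd_a₁_integralModelInt_of_goodOrd_or_mult (W : WeierstrassCurve ℚ) [W.IsElliptic]
    [W.IsGloballyMinimal] (h : Rank1Residual.GoodOrd W 2 ∨ Rank1Residual.Mult W 2) :
    Odd (integralModelInt W).a₁ := by
  rcases h with hgo | hm
  · have hodd : Odd (W.frobeniusTrace 2) := by
      rcases Int.even_or_odd (W.frobeniusTrace 2) with he | ho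
      · exact absurd (even_iff_two_dvd.mp he) hgo.2
      · exact ho
    exact odd_a₁_of_hasGoodReductionAtPrime_two_of_odd_frobeniusTrace_two W hgo.1 hodd
  · exact odd_a₁_of_hasMultiplicativeReductionAtPrime_two W hm

/-- **The `2`-adic dictionary: "ramified at `2`" ⟺ `v₂(a₂)` of a normal form is ODD.**  On a
globally minimal equation with `a₁` odd, for every change of variables `C` putting `W` in two-torsion
normal form with the rational `2`-torsion point `P = (C.r, C.t)` at `(0,0)`: `⟨P⟩` is ramified at `2`
(`v₂(C.r) < 0`) iff `v₂(a₂(C • W))` is odd.  (`v₂(C.r) ≥ 0 ⟹ v₂(b₂ + 12r) = 0`; `v₂(C.r) = -2 ⟹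
v₂(b₂ + 12r) = 1`; and `v₂(a₂) ≡ v₂(b₂ + 12r) (mod 2)`.) Also `a₂(C • W) ≠ 0`.
[cite: GreenbergLNM1716, §5 definition of "ramified at 2" (chunk p0168) and examples (chunks p0174, p0176)] [cite: SilvermanAEC2009, VII.3 and III.1] -/
theorem twoTorsionRamifiedAtTwo_iff_odd_padicValRat_a₂ (W : WeierstrassCurve ℚ) [W.IsElliptic]
    [W.IsGloballyMinimal] (ha₁ : Odd (integralModelInt W).a₁) (C : VariableChange ℚ)
    [(C • W).IsTwoTorsionNF] :
    (C • W).a₂ ≠ 0 ∧ (TwoTorsionRamifiedAtTwo C.r ↔ Odd (padicValRat 2 (C • W).a₂)) := by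
  haveI : Fact (Nat.Prime 2) := ⟨Nat.prime_two⟩
  have hx : HasRationalTwoTorsionX W C.r := hasRationalTwoTorsionX_of_isTwoTorsionNF_smul W C
  have hcubic := fourXCubed_r_eq_zero_of_isTwoTorsionNF_smul W C
  obtain ⟨h₂, h₄, h₆⟩ := b₂_b₄_b₆_eq_intCast W
  rw [h₂, h₄, h₆] at hcubic
  have hB₂ : Odd (integralModelInt W).b₂ := odd_b₂_integralModelInt_of_odd_a₁ W ha₁
  have hU : ((C.u⁻¹ : ℚˣ) : ℚ) = (C.u : ℚ)⁻¹ := Units.val_inv_eq_inv_val C.u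
  have hu0 : (C.u : ℚ) ≠ 0 := Units.ne_zero _
  -- `a₂ ≠ 0` from `b₂ + 12 r ≠ 0`
  have hne : W.b₂ + 12 * C.r ≠ 0 := by
    rw [h₂]
    rcases padicValRat_eq_neg_two_or_nonneg_of_hasRationalTwoTorsionX_of_odd_a₁ W ha₁ hx with hv | hv
    · exact (padicValRat_add_twelve_mul_eq_one hB₂ hcubic (by rw [hv]; norm_num)).1
    · exact (padicValRat_add_twelve_mul_eq_zero hB₂ hv).1
  have ha₂ne : (C • W).a₂ ≠ 0 := by
    intro h0
    have h4 := four_mul_a₂_of_isTwoTorsionNF_smul W C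
    rw [h0, mul_zero, hU] at h4
    exact (mul_ne_zero (pow_ne_zero _ (inv_ne_zero hu0)) hne) h4.symm
  refine ⟨ha₂ne, ?_⟩
  rw [padicValRat_a₂_smul_eq W C hne]
  unfold TwoTorsionRamifiedAtTwo
  rcases padicValRat_eq_neg_two_or_nonneg_of_hasRationalTwoTorsionX_of_odd_a₁ W ha₁ hx with hv | hv
  · -- ramified: `v₂(r) = -2`, `v₂(b₂ + 12r) = 1`
    have h1 : padicValRat 2 (W.b₂ + 12 * C.r) = 1 := by
      rw [h₂]; exact (padicValRat_add_twelve_mul_eq_one hB₂ hcubic (by rw [hv]; norm_num)).2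
    rw [h1, hv]
    exact ⟨fun _ ↦ ⟨-1 - padicValRat 2 (C.u : ℚ), by ring⟩, fun _ ↦ by norm_num⟩
  · -- unramified: `v₂(r) ≥ 0`, `v₂(b₂ + 12r) = 0`
    have h0 : padicValRat 2 (W.b₂ + 12 * C.r) = 0 := by
      rw [h₂]; exact (padicValRat_add_twelve_mul_eq_zero hB₂ hv).2
    rw [h0]
    constructor
    · intro hlt; exact absurd hlt (not_lt.mpr hv)
    · rintro ⟨k, hk⟩; exfalso; omega

/-- **The explicit `2`-isogeny flips the parity of `v₂(a₂)`**: `a₂(V') = -2·a₂(V)`, so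
`v₂(a₂(V')) = 1 + v₂(a₂(V))` (for `a₂(V) ≠ 0`). [cite: SilvermanAEC2009, III.4 Example 4.5] -/
theorem padicValRat_twoIsogenyCodomain_a₂ (V : WeierstrassCurve ℚ) (h : V.a₂ ≠ 0) :
    padicValRat 2 V.twoIsogenyCodomain.a₂ = 1 + padicValRat 2 V.a₂ := by
  haveI : Fact (Nat.Prime 2) := ⟨Nat.prime_two⟩
  rw [twoIsogenyCodomain_a₂, show (-2 : ℚ) * V.a₂ = -(2 * V.a₂) by ring, padicValRat.neg,
    padicValRat.mul two_ne_zero h, show (2 : ℚ) = ((2 : ℕ) : ℚ) by norm_num,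
    padicValRat.self one_lt_two]

/-- **"Ramified at `2`" is DUAL under `P ↦ P'`.**  Let `W`, `W'` be globally minimal equations with
`a₁` odd (good ordinary or multiplicative at `2`), `C • W` a two-torsion normal form of `W`
(`P = (C.r, C.t)`), and `C' • W' = (C • W).twoIsogenyCodomain` (so `W'` is the minimal equation of
`W/⟨P⟩` and `P' = (C'.r, C'.t)` generates the kernel of the dual isogeny).  Then `⟨P⟩` is ramified at
`2` iff `⟨P'⟩` is NOT: `⟨P⟩ ⊆ C₂(E) ⟺ ⟨P'⟩ ⊄ C₂(E')` — the kernel of the dual of an isogeny with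
étale (resp. connected) kernel of order `2` is connected (resp. étale).
[cite: GreenbergLNM1716, §5 definition of "ramified at 2" (chunk p0168), §2 (C_v)] [cite: SilvermanAEC2009, III.4 Example 4.5, III.6.1 and VII.2–VII.3] -/
theorem twoTorsionRamifiedAtTwo_iff_not_of_twoIsogeny (W W' : WeierstrassCurve ℚ) [W.IsElliptic]
    [W.IsGloballyMinimal] [W'.IsElliptic] [W'.IsGloballyMinimal]
    (ha₁ : Odd (integralModelInt W).a₁) (ha₁' : Odd (integralModelInt W').a₁)
    (C C' : VariableChange ℚ) [(C • W).IsTwoTorsionNF]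
    (hlink : C' • W' = (C • W).twoIsogenyCodomain) :
    TwoTorsionRamifiedAtTwo C.r ↔ ¬ TwoTorsionRamifiedAtTwo C'.r := by
  haveI : (C' • W').IsTwoTorsionNF := by rw [hlink]; infer_instance
  obtain ⟨hne, h1⟩ := twoTorsionRamifiedAtTwo_iff_odd_padicValRat_a₂ W ha₁ C
  obtain ⟨-, h2⟩ := twoTorsionRamifiedAtTwo_iff_odd_padicValRat_a₂ W' ha₁' C'
  rw [h1, h2, hlink, padicValRat_twoIsogenyCodomain_a₂ (C • W) hne, Int.odd_add]
  constructor
  · intro hv h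
    exact (Int.not_even_iff_odd.mpr hv) (h.mp odd_one)
  · intro h
    rcases Int.even_or_odd (padicValRat 2 (C • W).a₂) with he | ho
    · exact absurd (iff_of_true odd_one he) h
    · exact ho

end Ramified

/-! ### §4. Greenberg's Prop. 5.13 / 5.14 configurations along the isogeny -/

section Configurations

variable (W W' : WeierstrassCurve ℚ) [W.IsElliptic] [W.IsGloballyMinimal] [W'.IsElliptic]
  [W'.IsGloballyMinimal] (C C' : VariableChange ℚ)

/-- **Both conditions at once**: under `P ↦ P'` (the generator of the kernel of the dual `2`-isogeny,
on the minimal equations, `a₁` odd on both), «ramified at `2`» and «odd» are each replaced by their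
negation. [cite: GreenbergLNM1716, §5 (chunk p0168), Props. 5.13–5.14 (chunk p0170)] -/
theorem ramified_odd_dual_of_twoIsogeny (ha₁ : Odd (integralModelInt W).a₁)
    (ha₁' : Odd (integralModelInt W').a₁) [(C • W).IsTwoTorsionNF]
    (hlink : C' • W' = (C • W).twoIsogenyCodomain) :
    (TwoTorsionRamifiedAtTwo C.r ↔ ¬ TwoTorsionRamifiedAtTwo C'.r) ∧
      (TwoTorsionOdd W C.r ↔ ¬ TwoTorsionOdd W' C'.r) :=
  ⟨twoTorsionRamifiedAtTwo_iff_not_of_twoIsogeny W W' ha₁ ha₁' C C' hlink,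
    twoTorsionOdd_iff_not_of_twoIsogeny W W' C C' hlink⟩

/-- **Greenberg's Prop. 5.14 hypothesis is invariant under `P ↦ P'`**: «`⟨P⟩` ramified at `2` but not
odd, or odd but not ramified at `2`» holds at `(W, P)` iff it holds at `(W', P')` (the two branches are
exchanged).  So the printed `μ = 0` criterion at `2` is a property of the `ℤ/2`-linked PAIR.
[cite: GreenbergLNM1716, Prop. 5.14 (chunk p0170)] -/
theorem prop514Hypothesis_iff_of_twoIsogeny (ha₁ : Odd (integralModelInt W).a₁)
    (ha₁' : Odd (integralModelInt W').a₁) [(C • W).IsTwoTorsionNF]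
    (hlink : C' • W' = (C • W).twoIsogenyCodomain) :
    ((TwoTorsionRamifiedAtTwo C.r ∧ ¬ TwoTorsionOdd W C.r) ∨
        (TwoTorsionOdd W C.r ∧ ¬ TwoTorsionRamifiedAtTwo C.r)) ↔
      ((TwoTorsionRamifiedAtTwo C'.r ∧ ¬ TwoTorsionOdd W' C'.r) ∨
        (TwoTorsionOdd W' C'.r ∧ ¬ TwoTorsionRamifiedAtTwo C'.r)) := by
  obtain ⟨hR, hO⟩ := ramified_odd_dual_of_twoIsogeny W W' C C' ha₁ ha₁' hlink
  rw [hR, hO]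
  tauto

/-- **Greenberg's Prop. 5.13 hypothesis («ramified at `2` AND odd», `μ ≥ 1`) at `(W, P)` iff `⟨P'⟩` is
NEITHER ramified at `2` nor odd** — the configuration on which LNM 1716 §5 is silent.
[cite: GreenbergLNM1716, Prop. 5.13 (chunk p0168) and the Remark (chunk p0170)] -/
theorem ramified_and_odd_iff_neither_of_twoIsogeny (ha₁ : Odd (integralModelInt W).a₁)
    (ha₁' : Odd (integralModelInt W').a₁) [(C • W).IsTwoTorsionNF]
    (hlink : C' • W' = (C • W).twoIsogenyCodomain) :
    (TwoTorsionRamifiedAtTwo C.r ∧ TwoTorsionOdd W C.r) ↔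
      (¬ TwoTorsionRamifiedAtTwo C'.r ∧ ¬ TwoTorsionOdd W' C'.r) := by
  obtain ⟨hR, hO⟩ := ramified_odd_dual_of_twoIsogeny W W' C C' ha₁ ha₁' hlink
  rw [hR, hO]

/-- Conversely «neither» at `(W, P)` iff Prop. 5.13's hypothesis at `(W', P')`.
[cite: GreenbergLNM1716, Prop. 5.13 (chunk p0168)] -/
theorem neither_iff_ramified_and_odd_of_twoIsogeny (ha₁ : Odd (integralModelInt W).a₁)
    (ha₁' : Odd (integralModelInt W').a₁) [(C • W).IsTwoTorsionNF]
    (hlink : C' • W' = (C • W).twoIsogenyCodomain) :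
    (¬ TwoTorsionRamifiedAtTwo C.r ∧ ¬ TwoTorsionOdd W C.r) ↔
      (TwoTorsionRamifiedAtTwo C'.r ∧ TwoTorsionOdd W' C'.r) := by
  obtain ⟨hR, hO⟩ := ramified_odd_dual_of_twoIsogeny W W' C C' ha₁ ha₁' hlink
  rw [hR, hO, not_not, not_not]

/-- **The four configurations split two / two along the isogeny**: exactly one of «5.14 at both ends»
and «5.13 at one end, NEITHER at the other» occurs for a `ℤ/2`-linked pair of minimal equations with
`a₁` odd. [cite: GreenbergLNM1716, Props. 5.13–5.14 (chunks p0168–p0170)] -/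
theorem prop514_both_or_prop513_neither_of_twoIsogeny (ha₁ : Odd (integralModelInt W).a₁)
    (ha₁' : Odd (integralModelInt W').a₁) [(C • W).IsTwoTorsionNF]
    (hlink : C' • W' = (C • W).twoIsogenyCodomain) :
    (((TwoTorsionRamifiedAtTwo C.r ∧ ¬ TwoTorsionOdd W C.r) ∨
        (TwoTorsionOdd W C.r ∧ ¬ TwoTorsionRamifiedAtTwo C.r)) ∧
      ((TwoTorsionRamifiedAtTwo C'.r ∧ ¬ TwoTorsionOdd W' C'.r) ∨
        (TwoTorsionOdd W' C'.r ∧ ¬ TwoTorsionRamifiedAtTwo C'.r))) ∨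
    ((TwoTorsionRamifiedAtTwo C.r ∧ TwoTorsionOdd W C.r) ∧
      (¬ TwoTorsionRamifiedAtTwo C'.r ∧ ¬ TwoTorsionOdd W' C'.r)) ∨
    ((¬ TwoTorsionRamifiedAtTwo C.r ∧ ¬ TwoTorsionOdd W C.r) ∧
      (TwoTorsionRamifiedAtTwo C'.r ∧ TwoTorsionOdd W' C'.r)) := by
  obtain ⟨hR, hO⟩ := ramified_odd_dual_of_twoIsogeny W W' C C' ha₁ ha₁' hlink
  rw [hR, hO]
  tauto

/-- The same dualities with the reduction types spelled out: good ORDINARY or MULTIPLICATIVE at `2` on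
both minimal equations (as in Greenberg's Props. 5.13/5.14; isogenous curves have the same reduction
type, so in practice one hypothesis implies the other — not used here).
[cite: GreenbergLNM1716, Props. 5.13–5.14 (chunks p0168–p0170)] -/
theorem ramified_odd_dual_of_twoIsogeny_of_goodOrd_or_mult
    (hW : Rank1Residual.GoodOrd W 2 ∨ Rank1Residual.Mult W 2)
    (hW' : Rank1Residual.GoodOrd W' 2 ∨ Rank1Residual.Mult W' 2) [(C • W).IsTwoTorsionNF]
    (hlink : C' • W' = (C • W).twoIsogenyCodomain) :
    (TwoTorsionRamifiedAtTwo C.r ↔ ¬ TwoTorsionRamifiedAtTwo C'.r) ∧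
      (TwoTorsionOdd W C.r ↔ ¬ TwoTorsionOdd W' C'.r) :=
  ramified_odd_dual_of_twoIsogeny W W' C C' (odd_a₁_integralModelInt_of_goodOrd_or_mult W hW)
    (odd_a₁_integralModelInt_of_goodOrd_or_mult W' hW') hlink

end Configurations

end Literature.NumberTheory.EllipticCurves.Greenberg1999
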